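import Mathlib
import Literature.Analysis.FluidPDE.ChoiEtAl2017PeriodicHouLuoVelocity
import HarnessLib

/-!
# Choi–Hou–Kiselev–Luo–Šverák–Yao 2017, §4: `u_x = Hω` mode by mode — the log-sine cosine
# coefficients `∫₀^π log(sin t) cos(2kt) dt = −π/(2k)` and `Q[cos(2πk·/L)] = −(L/2πk) cos(2πk·/L)`

HONEST FRAMING (cell ns-blowup GROUP B «PROFILE SEARCH», zones Z3-b′ / Z8 = the Hou–Luo boundary
MODEL): **1-D MODEL (Hou–Luo), not Euler/NS.** Proof-only companion of
`ChoiEtAl2017PeriodicHouLuoBlowup.lean` and `…Velocity.lean`. Source: K. Choi, T. Y. Hou,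
A. Kiselev, G. Luo, V. Šverák, Y. Yao, Comm. Pure Appl. Math. **70** (2017) 2218–2243 =
arXiv:1407.4776 [ChoiHouKiselevLuoSverakYao2017], §4 p. 11 (eqn_m_hl_u): "`u_x = Hω`, `u = Qω`,
`Qω(x) = (1/π)∫₀ᴸ ω(y) log|sin[μ(x−y)]| dy` … the periodic analogs of the Hilbert transform on `ℝ`".
The statement `u_x = Hω` says that `Q` is the Fourier multiplier `−(L/2π|k|)` on the `k`-th mode
(`k ≠ 0`), since `H` is the multiplier `−i sgn k` ([cite: Grafakos2014, Ex. 4.1.4(c)], and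
`Literature.Analysis.Fourier.hilbertTransformCircle_cos/_sin` in the tree). Its content, mode by mode,
is the classical (Euler) cosine coefficient of `log(sin t)`:

  `∫₀^π log(sin t) cos(2kt) dt = −π/(2k)`  (`k ≥ 1`).

## What is proved (no definitions, no named facts; net debt 0)

* `integral_sin_two_mul_nat_mul_cot` — `∫₀^π sin(2kt) cot t dt = π` (`k ≥ 1`; telescoping
  `(sin 2(k+1)t − sin 2kt) cot t = cos 2(k+1)t + cos 2kt`, `sin 2t cot t = 1 + cos 2t`), with the
  integrability of the integrand;
* **`integral_log_sin_mul_cos`** — `∫₀^π log(sin t) cos(2kt) dt = −π/(2k)` for `k ≥ 1`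
  (integrate `(log(sin t) sin(2kt))′ = cot t sin 2kt + 2k log(sin t) cos 2kt` over `[0, π]`; the
  boundary terms vanish since `|sin 2kt · log sin t| ≤ 2k|sin t log sin t| → 0`);
* **`periodicHLVelocity_cos_mode`**, **`periodicHLVelocity_sin_mode`** — for `L > 0`, `k ≥ 1`:
  `Q[cos(2πk·/L)](x) = −(L/(2πk)) cos(2πkx/L)` and `Q[sin(2πk·/L)](x) = −(L/(2πk)) sin(2πkx/L)`,
  i.e. `(Q cos_k)′ = sin_k = H cos_k`, `(Q sin_k)′ = −cos_k = H sin_k`: the printed `u_x = Hω` on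
  every Fourier mode. (The `L²`-boundedness `‖(Qω)_x‖₂ ≤ ‖ω‖₂` needed for the uniqueness of
  smooth periodic HL solutions — stage [C] of the discharge of `choiEtAl2017_periodicHouLuo_blowup`
  — follows from these by Parseval; that step is not in this file.)

WHAT THIS IS NOT: not Euler, not Navier–Stokes — classical Fourier calculus of the 1-D periodic wall
MODEL's Biot–Savart law. `violates:` none — MODEL.
-/

noncomputable section

open Set Filter Real MeasureTheory intervalIntegral
open _root_.Topology

namespace Literature.Analysis.FluidPDE

namespace ChoiEtAl2017

/-! ### §1 Trigonometric preliminaries -/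

/-- `|sin(n t)| ≤ n |sin t|` for every natural `n`. [folklore] -/
private theorem abs_sin_nat_mul_le (n : ℕ) (t : ℝ) : |Real.sin (n * t)| ≤ n * |Real.sin t| := by
  induction n with
  | zero => simp
  | succ m ih =>
    have h : Real.sin ((m + 1 : ℕ) * t) = Real.sin (m * t) * Real.cos t + Real.cos (m * t) * Real.sin t := by
      push_cast
      rw [add_mul, one_mul, Real.sin_add]
    rw [h]
    push_cast
    have h1 : |Real.sin (m * t) * Real.cos t| ≤ m * |Real.sin t| := by
      rw [abs_mul]
      exact (mul_le_of_le_one_right (abs_nonneg _) (Real.abs_cos_le_one _)).trans ih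
    have h2 : |Real.cos (m * t) * Real.sin t| ≤ |Real.sin t| := by
      rw [abs_mul]
      exact mul_le_of_le_one_left (abs_nonneg _) (Real.abs_cos_le_one _)
    calc |Real.sin (m * t) * Real.cos t + Real.cos (m * t) * Real.sin t|
        ≤ |Real.sin (m * t) * Real.cos t| + |Real.cos (m * t) * Real.sin t| := abs_add_le _ _
      _ ≤ m * |Real.sin t| + |Real.sin t| := add_le_add h1 h2
      _ = (m + 1) * |Real.sin t| := by ring

/-- `sin 2t · cot t = 1 + cos 2t` for `sin t ≠ 0`. [folklore] -/
private theorem sin_two_mul_mul_cot {t : ℝ} (ht : Real.sin t ≠ 0) :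
    Real.sin (2 * t) * (Real.cos t / Real.sin t) = 1 + Real.cos (2 * t) := by
  rw [Real.sin_two_mul, Real.cos_two_mul]
  field_simp
  ring

/-- Telescoping: `(sin(2(k+1)t) − sin(2kt)) cot t = cos(2(k+1)t) + cos(2kt)` for `sin t ≠ 0`.
[folklore] -/
private theorem sin_succ_sub_sin_mul_cot (k : ℝ) {t : ℝ} (ht : Real.sin t ≠ 0) :
    (Real.sin (2 * (k + 1) * t) - Real.sin (2 * k * t)) * (Real.cos t / Real.sin t) =
      Real.cos (2 * (k + 1) * t) + Real.cos (2 * k * t) := by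
  rw [Real.sin_sub_sin, Real.cos_add_cos]
  have e1 : (2 * (k + 1) * t - 2 * k * t) / 2 = t := by ring
  have e2 : (2 * (k + 1) * t + 2 * k * t) / 2 = 2 * (k + 1) * t - t := by ring
  rw [e1, e2]
  field_simp

/-- `∫₀^π cos(m t) dt = 0` for every integer `m ≥ 1`. [folklore] -/
private theorem integral_cos_nat_mul' (m : ℕ) (hm : 1 ≤ m) :
    ∫ t in (0 : ℝ)..π, Real.cos ((m : ℝ) * t) = 0 := by
  have hm0 : (m : ℝ) ≠ 0 := by exact_mod_cast (Nat.one_le_iff_ne_zero.mp hm)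
  rw [intervalIntegral.integral_comp_mul_left (fun t => Real.cos t) hm0, integral_cos]
  simp [Real.sin_nat_mul_pi]

/-- On `(0, π)` the sine does not vanish. [folklore] -/
private theorem sin_ne_zero_of_mem_Ioo {t : ℝ} (ht : t ∈ Ioo (0 : ℝ) π) : Real.sin t ≠ 0 :=
  (Real.sin_pos_of_pos_of_lt_pi ht.1 ht.2).ne'

/-! ### §2 `∫₀^π sin(2kt) cot t dt = π` -/

/-- **`∫₀^π sin(2kt) cot t dt = π` for every integer `k ≥ 1`**, with the interval-integrability of
the integrand (the integrand agrees a.e. with the trigonometric polynomial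
`1 + cos 2t + Σ_{j<k}(cos 2(j+1)t + cos 2jt)`); by induction on `k` via the telescoping identity.
The full-angle form of the classical `∫₀^π sin(kt)cot(t/2) dt = π`
(`Literature.Analysis.Fourier.HilbertTransformCircle`). [cite: Grafakos2014, Ex. 4.1.4(c) (the conjugate function of a Fourier mode)] -/
theorem integral_sin_two_mul_nat_mul_cot (k : ℕ) (hk : 1 ≤ k) :
    IntervalIntegrable (fun t => Real.sin (2 * (k : ℝ) * t) * (Real.cos t / Real.sin t)) volume 0 π ∧
      ∫ t in (0 : ℝ)..π, Real.sin (2 * (k : ℝ) * t) * (Real.cos t / Real.sin t) = π := by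
  induction k with
  | zero => exact absurd hk (by norm_num)
  | succ n ih =>
    rcases Nat.eq_zero_or_pos n with hn | hn
    · subst hn
      have heq : ∀ᵐ t ∂(volume : Measure ℝ), t ∈ uIoc (0 : ℝ) π →
          (fun t : ℝ => Real.sin (2 * (((0 + 1 : ℕ) : ℝ)) * t) * (Real.cos t / Real.sin t)) t =
          (fun t => 1 + Real.cos (2 * t)) t := by
        have hπ : ∀ᵐ t ∂(volume : Measure ℝ), t ≠ π := by simp [ae_iff, measure_singleton]
        filter_upwards [hπ] with t htπ ht
        rw [uIoc_of_le Real.pi_pos.le] at ht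
        have hto : t ∈ Ioo (0 : ℝ) π := ⟨ht.1, lt_of_le_of_ne ht.2 htπ⟩
        have hc : (((0 + 1 : ℕ) : ℝ)) = 1 := by norm_num
        simp only [hc, mul_one]
        exact sin_two_mul_mul_cot (sin_ne_zero_of_mem_Ioo hto)
      have hc : IntervalIntegrable (fun t : ℝ => Real.cos (2 * t)) volume 0 π :=
        (by fun_prop : Continuous fun t : ℝ => Real.cos (2 * t)).intervalIntegrable _ _
      have hint : IntervalIntegrable (fun t : ℝ => 1 + Real.cos (2 * t)) volume 0 π :=
        intervalIntegrable_const.add hc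
      refine ⟨(hint.congr_ae ?_), ?_⟩
      · exact (ae_restrict_iff' measurableSet_uIoc).2 (heq.mono fun t ht hmem => (ht hmem).symm)
      rw [intervalIntegral.integral_congr_ae heq, intervalIntegral.integral_add intervalIntegrable_const hc]
      have h2 := integral_cos_nat_mul' 2 (by norm_num)
      push_cast at h2
      simp only [intervalIntegral.integral_const, smul_eq_mul, sub_zero, mul_one]
      linarith [h2]
    · obtain ⟨ihint, ihval⟩ := ih hn
      have heq : ∀ᵐ t ∂(volume : Measure ℝ), t ∈ uIoc (0 : ℝ) π →
          (fun t : ℝ => Real.sin (2 * (((n + 1 : ℕ) : ℝ)) * t) * (Real.cos t / Real.sin t)) t =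
          (fun t => Real.sin (2 * (n : ℝ) * t) * (Real.cos t / Real.sin t) +
            (Real.cos (2 * ((n : ℝ) + 1) * t) + Real.cos (2 * (n : ℝ) * t))) t := by
        have hπ : ∀ᵐ t ∂(volume : Measure ℝ), t ≠ π := by simp [ae_iff, measure_singleton]
        filter_upwards [hπ] with t htπ ht
        rw [uIoc_of_le Real.pi_pos.le] at ht
        have hto : t ∈ Ioo (0 : ℝ) π := ⟨ht.1, lt_of_le_of_ne ht.2 htπ⟩
        have h := sin_succ_sub_sin_mul_cot (n : ℝ) (sin_ne_zero_of_mem_Ioo hto)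
        simp only [Nat.cast_add, Nat.cast_one]
        linarith [h]
      have hc1 : Continuous fun t : ℝ => Real.cos (2 * ((n : ℝ) + 1) * t) := by fun_prop
      have hc2 : Continuous fun t : ℝ => Real.cos (2 * (n : ℝ) * t) := by fun_prop
      have hcos : IntervalIntegrable
          (fun t : ℝ => Real.cos (2 * ((n : ℝ) + 1) * t) + Real.cos (2 * (n : ℝ) * t)) volume 0 π :=
        (hc1.add hc2).intervalIntegrable _ _
      refine ⟨(ihint.add hcos).congr_ae ?_, ?_⟩
      · exact (ae_restrict_iff' measurableSet_uIoc).2 (heq.mono fun t ht hmem => (ht hmem).symm)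
      rw [intervalIntegral.integral_congr_ae heq, intervalIntegral.integral_add ihint hcos, ihval,
        intervalIntegral.integral_add (hc1.intervalIntegrable 0 π) (hc2.intervalIntegrable 0 π)]
      have h1 := integral_cos_nat_mul' (2 * (n + 1)) (by omega)
      have h2 := integral_cos_nat_mul' (2 * n) (by omega)
      push_cast at h1 h2
      have e1 : (fun t : ℝ => Real.cos (2 * ((n : ℝ) + 1) * t)) = fun t => Real.cos (2 * ((n : ℝ) + 1) * t) := rfl
      rw [show (∫ t in (0 : ℝ)..π, Real.cos (2 * ((n : ℝ) + 1) * t)) = 0 from h1,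
        show (∫ t in (0 : ℝ)..π, Real.cos (2 * (n : ℝ) * t)) = 0 from h2]
      ring

/-! ### §3 The cosine coefficients of `log(sin t)` -/

/-- `log(sin t)` is integrable on `[0, π]`. [folklore] -/
private theorem intervalIntegrable_log_sin : IntervalIntegrable (fun t => Real.log (Real.sin t)) volume 0 π := by
  have h := intervalIntegrable_log_abs_sin_phase π 0 π
  refine h.congr fun t _ => ?_
  have : π * t / π = t := by field_simp
  rw [this, Real.log_abs]

/-- **The cosine coefficients of `log sin`** (Euler): `∫₀^π log(sin t) cos(2kt) dt = −π/(2k)` for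
every integer `k ≥ 1` — the mode-by-mode content of the printed `u_x = Hω`, `u = Qω` (the kernel
`log|sin(μ·)|` of `Q` has `k`-th cosine coefficient `−L/(2k)`). Proof: integrate
`(log(sin t)·sin(2kt))′ = cot t·sin 2kt + 2k log(sin t) cos 2kt` over `[0,π]` (boundary values `0`:
`|sin 2kt · log sin t| ≤ 2k |sin t · log sin t| → 0`) and use `∫₀^π sin(2kt) cot t dt = π`.
[cite: ChoiHouKiselevLuoSverakYao2017, §4 p. 11 (eqn_m_hl_u: u_x = Hω, u = Qω — Q is the Fourier multiplier −L/(2π|k|))] -/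
theorem integral_log_sin_mul_cos (k : ℕ) (hk : 1 ≤ k) :
    ∫ t in (0 : ℝ)..π, Real.log (Real.sin t) * Real.cos (2 * (k : ℝ) * t) = -π / (2 * k) := by
  have hk0 : (0 : ℝ) < k := by exact_mod_cast hk
  -- `Φ = log(sin t) sin(2kt)` and its derivative on `(0, π)`
  set Φ : ℝ → ℝ := fun t => Real.log (Real.sin t) * Real.sin (2 * (k : ℝ) * t) with hΦ
  have hΦderiv : ∀ t ∈ Ioo (0 : ℝ) π, HasDerivAt Φ
      (Real.sin (2 * (k : ℝ) * t) * (Real.cos t / Real.sin t) +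
        2 * (k : ℝ) * (Real.log (Real.sin t) * Real.cos (2 * (k : ℝ) * t))) t := by
    intro t ht
    have hs := sin_ne_zero_of_mem_Ioo ht
    have h1 : HasDerivAt (fun t => Real.log (Real.sin t)) (Real.cos t / Real.sin t) t :=
      (Real.hasDerivAt_sin t).log hs
    have h2 : HasDerivAt (fun t => Real.sin (2 * (k : ℝ) * t))
        (Real.cos (2 * (k : ℝ) * t) * (2 * (k : ℝ))) t := by
      have h := ((hasDerivAt_id t).const_mul (2 * (k : ℝ))).sin
      simpa using h
    have h := h1.mul h2
    refine h.congr_deriv ?_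
    ring
  -- continuity of `Φ` on `[0, π]`: squeeze at the endpoints
  have hbound : ∀ t, |Φ t| ≤ 2 * (k : ℝ) * |Real.sin t * Real.log (Real.sin t)| := by
    intro t
    rw [hΦ]; dsimp only
    rw [abs_mul, mul_comm (|Real.log (Real.sin t)|)]
    have h := abs_sin_nat_mul_le (2 * k) t
    push_cast at h
    calc |Real.sin (2 * (k : ℝ) * t)| * |Real.log (Real.sin t)|
        ≤ 2 * (k : ℝ) * |Real.sin t| * |Real.log (Real.sin t)| :=
          mul_le_mul_of_nonneg_right h (abs_nonneg _)
      _ = 2 * (k : ℝ) * |Real.sin t * Real.log (Real.sin t)| := by rw [abs_mul]; ring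
  have hg : Continuous fun t => 2 * (k : ℝ) * |Real.sin t * Real.log (Real.sin t)| :=
    continuous_const.mul (continuous_abs.comp (Real.continuous_mul_log.comp Real.continuous_sin))
  have hΦcont : ContinuousOn Φ (Icc 0 π) := by
    intro t ht
    by_cases hint : t ∈ Ioo (0 : ℝ) π
    · exact (hΦderiv t hint).continuousAt.continuousWithinAt
    · -- `t = 0` or `t = π`: `Φ t = 0` and `|Φ| ≤ g → g t = 0`
      have hsin : Real.sin t = 0 := by
        rcases eq_or_lt_of_le ht.1 with h0 | h0
        · rw [← h0, Real.sin_zero]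
        · have : t = π := by
            by_contra hne
            exact hint ⟨h0, lt_of_le_of_ne ht.2 hne⟩
          rw [this, Real.sin_pi]
      have hΦt : Φ t = 0 := by simp [hΦ, hsin]
      have hgt : 2 * (k : ℝ) * |Real.sin t * Real.log (Real.sin t)| = 0 := by simp [hsin]
      have hlim : Tendsto (fun s => 2 * (k : ℝ) * |Real.sin s * Real.log (Real.sin s)|)
          (𝓝[Icc 0 π] t) (𝓝 0) := by
        have h := (hg.tendsto t).mono_left (nhdsWithin_le_nhds (s := Icc 0 π))
        rwa [hgt] at h
      have hT : Tendsto Φ (𝓝[Icc 0 π] t) (𝓝 0) :=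
        squeeze_zero_norm' (Eventually.of_forall fun s => by
          rw [Real.norm_eq_abs]; exact hbound s) hlim
      rw [ContinuousWithinAt, hΦt]
      exact hT
  -- integrability of `Φ'`
  obtain ⟨hJint, hJval⟩ := integral_sin_two_mul_nat_mul_cot k hk
  have hLint : IntervalIntegrable (fun t => Real.log (Real.sin t) * Real.cos (2 * (k : ℝ) * t))
      volume 0 π :=
    intervalIntegrable_log_sin.mul_continuousOn ((by fun_prop : Continuous fun t : ℝ =>
      Real.cos (2 * (k : ℝ) * t)).continuousOn)
  have hΦ'int : IntervalIntegrable (fun t => Real.sin (2 * (k : ℝ) * t) * (Real.cos t / Real.sin t) +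
      2 * (k : ℝ) * (Real.log (Real.sin t) * Real.cos (2 * (k : ℝ) * t))) volume 0 π :=
    hJint.add (hLint.const_mul _)
  -- FTC
  have hFTC := intervalIntegral.integral_eq_sub_of_hasDerivAt_of_le Real.pi_pos.le hΦcont hΦderiv hΦ'int
  have hΦ0 : Φ 0 = 0 := by simp [hΦ]
  have hΦπ : Φ π = 0 := by simp [hΦ, Real.sin_pi]
  rw [hΦ0, hΦπ, sub_zero, intervalIntegral.integral_add hJint (hLint.const_mul _), hJval,
    intervalIntegral.integral_const_mul] at hFTC
  -- `π + 2k ∫ log sin cos 2kt = 0`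
  have hk2 : (2 : ℝ) * k ≠ 0 := by positivity
  field_simp
  linarith

/-! ### §4 `Q` on the Fourier modes: `Q[cos_k] = −(L/2πk) cos_k`, `Q[sin_k] = −(L/2πk) sin_k` -/

/-- The cosine coefficient of the kernel: `∫₀ᴸ cos(2kμz) log|sin(μz)| dz = −L/(2k)`, `μ = π/L`,
`k ≥ 1`. [cite: ChoiHouKiselevLuoSverakYao2017, §4 p. 11 (eqn_m_hl_u: u_x = Hω)] -/
theorem integral_cos_mode_mul_log_abs_sin {L : ℝ} (hL : 0 < L) (k : ℕ) (hk : 1 ≤ k) :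
    ∫ z in (0 : ℝ)..L, Real.cos (2 * (k : ℝ) * (π / L * z)) * Real.log |Real.sin (π / L * z)| =
      -L / (2 * k) := by
  have hc : π / L ≠ 0 := (div_pos Real.pi_pos hL).ne'
  have h := intervalIntegral.integral_comp_mul_left
    (fun t => Real.cos (2 * (k : ℝ) * t) * Real.log |Real.sin t|) hc (a := 0) (b := L)
  rw [h, mul_zero, show π / L * L = π by field_simp, smul_eq_mul]
  have hmain : ∫ t in (0 : ℝ)..π, Real.cos (2 * (k : ℝ) * t) * Real.log |Real.sin t| = -π / (2 * k) := by
    rw [← integral_log_sin_mul_cos k hk]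
    refine intervalIntegral.integral_congr fun t _ => ?_
    simp only [Real.log_abs]
    ring
  rw [hmain]
  have hk0 : (0 : ℝ) < k := by exact_mod_cast hk
  field_simp

/-- The sine coefficient of the kernel vanishes: `∫₀ᴸ sin(2kμz) log|sin(μz)| dz = 0` (symmetry
`z ↦ L − z`). [cite: ChoiHouKiselevLuoSverakYao2017, §4 p. 11 (eqn_m_hl_u: u_x = Hω)] -/
theorem integral_sin_mode_mul_log_abs_sin {L : ℝ} (hL : 0 < L) (k : ℕ) :
    ∫ z in (0 : ℝ)..L, Real.sin (2 * (k : ℝ) * (π / L * z)) * Real.log |Real.sin (π / L * z)| = 0 := by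
  set f : ℝ → ℝ := fun z => Real.sin (2 * (k : ℝ) * (π / L * z)) * Real.log |Real.sin (π / L * z)|
    with hf
  have hsymm : ∀ z, f (L - z) = -f z := by
    intro z
    simp only [hf]
    have h1 : π / L * (L - z) = π - π / L * z := by field_simp
    have h2 : 2 * (k : ℝ) * (π - π / L * z) = (k : ℕ) * (2 * π) - 2 * (k : ℝ) * (π / L * z) := by
      ring
    rw [h1, Real.sin_pi_sub, h2, Real.sin_nat_mul_two_pi_sub]
    ring
  have h := intervalIntegral.integral_comp_sub_left f L (a := 0) (b := L)
  rw [sub_self, sub_zero] at h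
  have h2 : ∫ z in (0 : ℝ)..L, f (L - z) = -∫ z in (0 : ℝ)..L, f z := by
    rw [← intervalIntegral.integral_neg]
    exact intervalIntegral.integral_congr fun z _ => hsymm z
  show ∫ z in (0 : ℝ)..L, f z = 0
  linarith

/-- The kernel `log|sin(μ·)|` times a continuous function is integrable on `[0, L]`. [folklore] -/
private theorem intervalIntegrable_mul_log_abs_sin' {g : ℝ → ℝ} (hg : Continuous g) (L : ℝ) :
    IntervalIntegrable (fun z => g z * Real.log |Real.sin (π / L * z)|) volume 0 L := by
  have h := (intervalIntegrable_log_abs_sin_phase L 0 L).continuousOn_mul hg.continuousOn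
  refine h.congr fun z _ => ?_
  rw [show π / L * z = π * z / L by ring]

/-- **`Q[cos(2πk·/L)] = −(L/(2πk))·cos(2πk·/L)`** (`L > 0`, `k ≥ 1`): the printed `u_x = Hω`,
`u = Qω` on the `k`-th cosine mode (`(Q cos_k)′ = sin_k = H cos_k`, the multiplier `−i sgn k` of
the periodic Hilbert transform). [cite: ChoiHouKiselevLuoSverakYao2017, §4 p. 11 (eqn_m_hl_u: u_x = Hω, u = Qω)] -/
theorem periodicHLVelocity_cos_mode {L : ℝ} (hL : 0 < L) (k : ℕ) (hk : 1 ≤ k) (x : ℝ) :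
    periodicHLVelocity L (fun y => Real.cos (2 * (k : ℝ) * (π / L * y))) x =
      -(L / (2 * π * k)) * Real.cos (2 * (k : ℝ) * (π / L * x)) := by
  have hper : Function.Periodic (fun y => Real.cos (2 * (k : ℝ) * (π / L * y))) L := by
    intro y
    have : 2 * (k : ℝ) * (π / L * (y + L)) = 2 * (k : ℝ) * (π / L * y) + (k : ℕ) * (2 * π) := by
      field_simp
    dsimp only
    rw [this, Real.cos_add_nat_mul_two_pi]
  rw [periodicHLVelocity_eq_conv hL hper x]
  have hsplit : ∀ z, Real.cos (2 * (k : ℝ) * (π / L * (x - z))) * Real.log |Real.sin (π * z / L)| =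
      Real.cos (2 * (k : ℝ) * (π / L * x)) *
        (Real.cos (2 * (k : ℝ) * (π / L * z)) * Real.log |Real.sin (π / L * z)|) +
      Real.sin (2 * (k : ℝ) * (π / L * x)) *
        (Real.sin (2 * (k : ℝ) * (π / L * z)) * Real.log |Real.sin (π / L * z)|) := by
    intro z
    have h1 : 2 * (k : ℝ) * (π / L * (x - z)) = 2 * (k : ℝ) * (π / L * x) - 2 * (k : ℝ) * (π / L * z) := by
      ring
    have h2 : π * z / L = π / L * z := by ring
    rw [h1, Real.cos_sub, h2]
    ring
  simp_rw [hsplit]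
  have hi1 := intervalIntegrable_mul_log_abs_sin'
    (by fun_prop : Continuous fun z : ℝ => Real.cos (2 * (k : ℝ) * (π / L * z))) L
  have hi2 := intervalIntegrable_mul_log_abs_sin'
    (by fun_prop : Continuous fun z : ℝ => Real.sin (2 * (k : ℝ) * (π / L * z))) L
  rw [intervalIntegral.integral_add (hi1.const_mul _) (hi2.const_mul _),
    intervalIntegral.integral_const_mul, intervalIntegral.integral_const_mul,
    integral_cos_mode_mul_log_abs_sin hL k hk, integral_sin_mode_mul_log_abs_sin hL k]
  have hk0 : (0 : ℝ) < k := by exact_mod_cast hk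
  field_simp
  ring

/-- **`Q[sin(2πk·/L)] = −(L/(2πk))·sin(2πk·/L)`** (`L > 0`, `k ≥ 1`): `u_x = Hω` on the `k`-th
sine mode (`(Q sin_k)′ = −cos_k = H sin_k`). [cite: ChoiHouKiselevLuoSverakYao2017, §4 p. 11 (eqn_m_hl_u: u_x = Hω, u = Qω)] -/
theorem periodicHLVelocity_sin_mode {L : ℝ} (hL : 0 < L) (k : ℕ) (hk : 1 ≤ k) (x : ℝ) :
    periodicHLVelocity L (fun y => Real.sin (2 * (k : ℝ) * (π / L * y))) x =
      -(L / (2 * π * k)) * Real.sin (2 * (k : ℝ) * (π / L * x)) := by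
  have hper : Function.Periodic (fun y => Real.sin (2 * (k : ℝ) * (π / L * y))) L := by
    intro y
    have : 2 * (k : ℝ) * (π / L * (y + L)) = 2 * (k : ℝ) * (π / L * y) + (k : ℕ) * (2 * π) := by
      field_simp
    dsimp only
    rw [this, Real.sin_add_nat_mul_two_pi]
  rw [periodicHLVelocity_eq_conv hL hper x]
  have hsplit : ∀ z, Real.sin (2 * (k : ℝ) * (π / L * (x - z))) * Real.log |Real.sin (π * z / L)| =
      Real.sin (2 * (k : ℝ) * (π / L * x)) *
        (Real.cos (2 * (k : ℝ) * (π / L * z)) * Real.log |Real.sin (π / L * z)|) -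
      Real.cos (2 * (k : ℝ) * (π / L * x)) *
        (Real.sin (2 * (k : ℝ) * (π / L * z)) * Real.log |Real.sin (π / L * z)|) := by
    intro z
    have h1 : 2 * (k : ℝ) * (π / L * (x - z)) = 2 * (k : ℝ) * (π / L * x) - 2 * (k : ℝ) * (π / L * z) := by
      ring
    have h2 : π * z / L = π / L * z := by ring
    rw [h1, Real.sin_sub, h2]
    ring
  simp_rw [hsplit]
  have hi1 := intervalIntegrable_mul_log_abs_sin'
    (by fun_prop : Continuous fun z : ℝ => Real.cos (2 * (k : ℝ) * (π / L * z))) L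
  have hi2 := intervalIntegrable_mul_log_abs_sin'
    (by fun_prop : Continuous fun z : ℝ => Real.sin (2 * (k : ℝ) * (π / L * z))) L
  rw [intervalIntegral.integral_sub (hi1.const_mul _) (hi2.const_mul _),
    intervalIntegral.integral_const_mul, intervalIntegral.integral_const_mul,
    integral_cos_mode_mul_log_abs_sin hL k hk, integral_sin_mode_mul_log_abs_sin hL k]
  have hk0 : (0 : ℝ) < k := by exact_mod_cast hk
  field_simp
  ring

end ChoiEtAl2017

end Literature.Analysis.FluidPDE
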